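import Summits.AtomisticToContinuum.HydrodynamicLimit.Theorems.TwoClocksEquilibriumFastWindowLDBirthT12SphereCyl
import HarnessLib

/-!
# Circle averages: Funk–Hecke for circles, the circle-average form of the far-field gain operator
# (FACT F), and two zonal steps as an iterated circle average (F3)
# (helpers `t12_lorentzGain_circleAvg`, `t12_funkHecke_circle` of the line `birth`, crux
# `TwoClocks.EquilibriumFastWindowLD`, stmt-AtomisticToContinuum-14440; FF2/Z5-infrastructure towards the
# registered analytic sub-goal `t12_logLinearPreimage_and_dipoleModulus`)

Write `(A_z Y)(n) := (2π)⁻¹ ∫_{-π}^{π} Y(z n + √(1-z²)(cos φ e₁ n + sin φ e₂ n)) dφ` for the normalised average of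
an angular profile `Y` over the circle `{ω ∈ S² : ⟪ω, n⟫ = z}` (unit `n`, frame `Lambert.e₁/e₂`; kept
EXPANDED in all statements, no new definition). From the cylindrical coordinates `dσ = dz dφ` of the sibling
file `…T12SphereCyl` and the zonal form of the Lorentz operator of `…T12LorentzAngular`:

* **Funk–Hecke for circles** (`lintegral_sphere_zonal_mul_eq_cyl`, `integral_sphere_zonal_mul_eq_cyl`,
  `integral_sphere_zonal_mul_eq_intervalIntegral`; registered `t12_funkHecke_circle`; integrability
  `integrable_sphere_zonal_mul`): `∫_{S²} k(⟪n, ν⟫) Y(ν) dσ(ν) = 2π ∫_{-1}^{1} k(z) (A_z Y)(n) dz` — a zonal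
  weight sees the height only, the profile enters through its circle averages (Z5 of the plan with the
  angular variable retained; `k = 1, x` give the zonal average and the dipole moment along `n`).
* **FACT F** (`lorentzGain_smul_eq_circleAvg`, registered `t12_lorentzGain_circleAvg`; separable case
  `lorentzGain_smul_eq_circleAvg_of_separable`): for `u` measurable and bounded on bounded sets,
  `lorentzGain u (s n) = πs ∫₀¹ 4z (A_z u(sz ·))(n) dz` — the formula `(ν⁻¹K₂^∞u)(sn) = ∫₀¹ 4ρ (A_ρ u(ρs ·))(n) dρ`
  of plan §2 at the level of the Lorentz operator (`ν ≈ πs`), from which the whole multiplier table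
  `λ_ℓ(α) = 4∫₀¹ρ^{α+1}P_ℓ(ρ)dρ` descends once `A_ρ Y_ℓ = P_ℓ(ρ) Y_ℓ` is available.
* **F3, two steps** (`integral_sphere_zonal_zonal_eq_cyl`, with `measurable_integral_sphere_zonal_mul` and the
  sup bound `abs_integral_sphere_zonal_mul_le`: `|K Y| ≤ 2π‖k‖₁ m`): the twice-applied zonal operator
  `(K Y)(x) = ∫ k(⟪x, ω⟫) Y(ω) dσ(ω)` is the iterated circle average
  `(K(KY))(n) = ∫ k(z₁) ∫dφ₁ ∫ k(z₂) ∫dφ₂ Y(z₂ c₁ + √(1-z₂²)(cos φ₂ e₁ c₁ + sin φ₂ e₂ c₁))`, `c₁` the circle point of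
  `(z₁, φ₁)` about `n` — i.e. `(2π)² ∫∫ k(z₁) k(z₂) (A_{z₁}(A_{z₂} Y))(n) dz₁ dz₂`, the representation "as an
  average of compositions of circle averages" that FF2 asks for (with `k = (2/π)x₊²` the two-step far-field
  kernel on the linear-growth class).

All statements are [folklore] (Funk 1916 / Hecke 1918 for zonal kernels; here only the elementary circle form).
-/

noncomputable section

open MeasureTheory Real Set Filter Metric
open scoped ENNReal BigOperators InnerProductSpace
namespace Summit.AtomisticToContinuum.HydrodynamicLimit.Theorems.ClampedCorrectorBirth

open Literature.Analysis.FluidPDE Literature.MathematicalPhysics.KineticTheory Literature.Analysis.Calculus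

/-! ### Funk–Hecke for circles: a zonal weight against an angular profile -/

/-- **Funk–Hecke for circles, `lintegral` form**: for unit `n`, measurable `k ≥ 0` on `ℝ` and `F ≥ 0` on `ℝ³`,
`∫_{S²} k(⟪n, ν⟫) F(ν) dσ(ν) = ∫_{(-1,1)} k(z) ∫_{(-π,π)} F(z n + √(1-z²)(cos φ e₁ n + sin φ e₂ n)) dφ dz`
— the zonal weight sees only the height, the profile is averaged over the circles (`2π A_z F`). [folklore] -/
theorem lintegral_sphere_zonal_mul_eq_cyl {n : EuclideanSpace ℝ (Fin 3)} (hn : ‖n‖ = 1) {k : ℝ → ℝ≥0∞}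
    (hk : Measurable k) {F : EuclideanSpace ℝ (Fin 3) → ℝ≥0∞} (hF : Measurable F) :
    ∫⁻ ν : sphere (0 : EuclideanSpace ℝ (Fin 3)) 1, k ⟪n, (ν : EuclideanSpace ℝ (Fin 3))⟫_ℝ * F ν ∂sphereMeasure =
      ∫⁻ z in Ioo (-1:ℝ) 1, k z * ∫⁻ φ in Ioo (-π) π,
        F (z • n + √(1 - z ^ 2) • (cos φ • Lambert.e₁ n + sin φ • Lambert.e₂ n)) := by
  have hm : Measurable fun x : EuclideanSpace ℝ (Fin 3) => k ⟪n, x⟫_ℝ * F x :=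
    (hk.comp (measurable_const.inner measurable_id)).mul hF
  rw [lintegral_sphere_eq_cyl hn hm]
  refine setLIntegral_congr_fun measurableSet_Ioo fun z _ => ?_
  simp_rw [inner_self_cylPoint hn]
  have hmz : Measurable fun φ : ℝ => F (z • n + √(1 - z ^ 2) • (cos φ • Lambert.e₁ n + sin φ • Lambert.e₂ n)) :=
    hF.comp (by fun_prop)
  rw [lintegral_const_mul _ hmz]

/-- **Funk–Hecke for circles, Bochner form**: for unit `n`, `k : ℝ → ℝ` and `Y : ℝ³ → ℝ` measurable with
`k(⟪n, ·⟫) Y` integrable on the sphere: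
`∫_{S²} k(⟪n, ν⟫) Y(ν) dσ(ν) = ∫_{(-1,1)} k(z) ∫_{(-π,π)} Y(z n + √(1-z²)(cos φ e₁ n + sin φ e₂ n)) dφ dz = 2π ∫_{-1}^{1} k(z) (A_z Y)(n) dz`.
With `k ≡ 1`, `k = x` this recovers the zonal average and the dipole moment along `n` as integrals of circle
averages (Z5 of the plan: only `P₀, P₁` are ever needed). [folklore] -/
theorem integral_sphere_zonal_mul_eq_cyl {n : EuclideanSpace ℝ (Fin 3)} (hn : ‖n‖ = 1) {k : ℝ → ℝ}
    (hk : Measurable k) {Y : EuclideanSpace ℝ (Fin 3) → ℝ} (hY : Measurable Y)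
    (hi : Integrable (fun ν : sphere (0 : EuclideanSpace ℝ (Fin 3)) 1 =>
      k ⟪n, (ν : EuclideanSpace ℝ (Fin 3))⟫_ℝ * Y ν) sphereMeasure) :
    ∫ ν : sphere (0 : EuclideanSpace ℝ (Fin 3)) 1, k ⟪n, (ν : EuclideanSpace ℝ (Fin 3))⟫_ℝ * Y ν ∂sphereMeasure =
      ∫ z in Ioo (-1:ℝ) 1, k z * ∫ φ in Ioo (-π) π,
        Y (z • n + √(1 - z ^ 2) • (cos φ • Lambert.e₁ n + sin φ • Lambert.e₂ n)) := by
  have hm : Measurable fun x : EuclideanSpace ℝ (Fin 3) => k ⟪n, x⟫_ℝ * Y x :=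
    (hk.comp (measurable_const.inner measurable_id)).mul hY
  rw [integral_sphere_eq_cyl hn hm.stronglyMeasurable hi]
  refine setIntegral_congr_fun measurableSet_Ioo fun z _ => ?_
  simp_rw [inner_self_cylPoint hn]
  exact integral_const_mul _ _

/-- The same with interval integrals: `∫_{S²} k(⟪n, ν⟫) Y(ν) dσ(ν) = ∫_{-1}^{1} k(z) ∫_{-π}^{π} Y(…) dφ dz`. [folklore] -/
theorem integral_sphere_zonal_mul_eq_intervalIntegral {n : EuclideanSpace ℝ (Fin 3)} (hn : ‖n‖ = 1) {k : ℝ → ℝ}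
    (hk : Measurable k) {Y : EuclideanSpace ℝ (Fin 3) → ℝ} (hY : Measurable Y)
    (hi : Integrable (fun ν : sphere (0 : EuclideanSpace ℝ (Fin 3)) 1 =>
      k ⟪n, (ν : EuclideanSpace ℝ (Fin 3))⟫_ℝ * Y ν) sphereMeasure) :
    ∫ ν : sphere (0 : EuclideanSpace ℝ (Fin 3)) 1, k ⟪n, (ν : EuclideanSpace ℝ (Fin 3))⟫_ℝ * Y ν ∂sphereMeasure =
      ∫ z in (-1:ℝ)..1, k z * ∫ φ in (-π)..π,
        Y (z • n + √(1 - z ^ 2) • (cos φ • Lambert.e₁ n + sin φ • Lambert.e₂ n)) := by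
  rw [integral_sphere_zonal_mul_eq_cyl hn hk hY hi, intervalIntegral.integral_of_le (by norm_num),
    integral_Ioc_eq_integral_Ioo]
  refine setIntegral_congr_fun measurableSet_Ioo fun z _ => ?_
  rw [intervalIntegral.integral_of_le (by linarith [pi_pos]), integral_Ioc_eq_integral_Ioo]

/-- Integrability for Funk–Hecke: `k` integrable on `[-1, 1]` and `Y` measurable and bounded on the unit
sphere suffice. [folklore] -/
theorem integrable_sphere_zonal_mul {n : EuclideanSpace ℝ (Fin 3)} (hn : ‖n‖ = 1) {k : ℝ → ℝ}
    (hk : IntervalIntegrable k volume (-1) 1) {Y : EuclideanSpace ℝ (Fin 3) → ℝ} (hY : Measurable Y) {m : ℝ}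
    (hm : ∀ x : EuclideanSpace ℝ (Fin 3), ‖x‖ = 1 → |Y x| ≤ m) :
    Integrable (fun ν : sphere (0 : EuclideanSpace ℝ (Fin 3)) 1 =>
      k ⟪n, (ν : EuclideanSpace ℝ (Fin 3))⟫_ℝ * Y ν) sphereMeasure :=
  (integrable_sphere_comp_inner_of_intervalIntegrable hn hk).mul_bdd
    (hY.comp continuous_subtype_val.measurable).aestronglyMeasurable
    (Eventually.of_forall fun ν => by rw [Real.norm_eq_abs]; exact hm _ (by simp))

/-! ### FACT F: the far-field gain operator as an integral of circle averages -/

/-- **FACT F of the corrector-growth plan — the far-field gain operator as an integral of circle averages.**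
For a unit vector `n`, `0 ≤ s` and `u : ℝ³ → ℝ` measurable and bounded on bounded sets:
`lorentzGain u (s n) = πs ∫₀¹ 4z · (A_z u(sz ·))(n) dz`,
`(A_z Y)(n) = (2π)⁻¹ ∫_{-π}^{π} Y(z n + √(1-z²)(cos φ e₁ n + sin φ e₂ n)) dφ` the average over the circle
`{ω ∈ S² : ⟪ω, n⟫ = z}`: one far-field collision step moves `u` from radius `s` to radius `zs` with the law
`4z dz` (mass `2 = λ₀(0)`, own `+` partner, `lorentzGain_radial`) and averages the angular variable over the
circle of height `z` about the incoming direction (zonal form `lorentzGain_smul` + cylindrical coordinates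
`integral_sphere_eq_cyl`). With `ν(v) ≈ π‖v‖` this is `(ν⁻¹K₂^∞u)(sn) = ∫₀¹ 4ρ (A_ρ u(ρs ·))(n) dρ`. [folklore] -/
theorem lorentzGain_smul_eq_circleAvg {n : EuclideanSpace ℝ (Fin 3)} (hn : ‖n‖ = 1) {s : ℝ} (hs : 0 ≤ s)
    {u : EuclideanSpace ℝ (Fin 3) → ℝ} (hu : Measurable u) (hb : ∀ R : ℝ, ∃ C : ℝ, ∀ x, ‖x‖ ≤ R → |u x| ≤ C) :
    lorentzGain u (s • n) = π * s * ∫ z in (0:ℝ)..1, 4 * z * ((2 * π)⁻¹ * ∫ φ in (-π)..π,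
      u ((s * z) • (z • n + √(1 - z ^ 2) • (cos φ • Lambert.e₁ n + sin φ • Lambert.e₂ n)))) := by
  obtain ⟨C, hC⟩ := hb s
  have hC0 : 0 ≤ C := (abs_nonneg _).trans (hC 0 (by rw [norm_zero]; exact hs))
  have hm : Measurable fun x : EuclideanSpace ℝ (Fin 3) => max ⟪n, x⟫_ℝ 0 * u ((s * ⟪n, x⟫_ℝ) • x) :=
    ((measurable_const.inner measurable_id).max measurable_const).mul
      (hu.comp (((measurable_const.inner measurable_id).const_mul s).smul measurable_id))
  have hbd : ∀ ν : sphere (0 : EuclideanSpace ℝ (Fin 3)) 1,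
      |max ⟪n, (ν : EuclideanSpace ℝ (Fin 3))⟫_ℝ 0 *
        u ((s * ⟪n, (ν : EuclideanSpace ℝ (Fin 3))⟫_ℝ) • (ν : EuclideanSpace ℝ (Fin 3)))| ≤ C := by
    intro ν
    have hν : ‖(ν : EuclideanSpace ℝ (Fin 3))‖ = 1 := by simp
    have hz : |⟪n, (ν : EuclideanSpace ℝ (Fin 3))⟫_ℝ| ≤ 1 := by
      simpa [hn, hν] using abs_real_inner_le_norm n (ν : EuclideanSpace ℝ (Fin 3))
    have h1 : |max ⟪n, (ν : EuclideanSpace ℝ (Fin 3))⟫_ℝ 0| ≤ 1 := by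
      rw [abs_of_nonneg (le_max_right _ _)]
      exact max_le ((le_abs_self _).trans hz) zero_le_one
    have h2 : |u ((s * ⟪n, (ν : EuclideanSpace ℝ (Fin 3))⟫_ℝ) • (ν : EuclideanSpace ℝ (Fin 3)))| ≤ C := by
      refine hC _ ?_
      rw [norm_smul, hν, mul_one, Real.norm_eq_abs, abs_mul, abs_of_nonneg hs]
      exact mul_le_of_le_one_right hs hz
    rw [abs_mul]
    calc _ ≤ 1 * C := mul_le_mul h1 h2 (abs_nonneg _) zero_le_one
      _ = C := one_mul C
  have hi : Integrable (fun ν : sphere (0 : EuclideanSpace ℝ (Fin 3)) 1 =>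
      max ⟪n, (ν : EuclideanSpace ℝ (Fin 3))⟫_ℝ 0 *
        u ((s * ⟪n, (ν : EuclideanSpace ℝ (Fin 3))⟫_ℝ) • (ν : EuclideanSpace ℝ (Fin 3)))) sphereMeasure := by
    haveI := isFiniteMeasure_sphereMeasure (E := EuclideanSpace ℝ (Fin 3))
    exact (integrable_const C).mono' (hm.comp measurable_subtype_coe).aestronglyMeasurable
      (Eventually.of_forall fun ν => by rw [Real.norm_eq_abs]; exact hbd ν)
  rw [lorentzGain_smul hs hu, integral_sphere_eq_cyl hn hm.stronglyMeasurable hi]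
  simp_rw [inner_self_cylPoint hn]
  -- the height integral lives on `(0, 1)`
  rw [setIntegral_eq_of_subset_of_forall_sdiff_eq_zero (s := Ioo (0:ℝ) 1) measurableSet_Ioo
    (Ioo_subset_Ioo (by norm_num) le_rfl) (fun z hz => by
      have hz0 : z ≤ 0 := le_of_not_gt fun h => hz.2 ⟨h, hz.1.2⟩
      simp [max_eq_right hz0])]
  -- both sides are `2s ∫₀¹ z ∫ u dφ dz`
  have hL : ∫ z in Ioo (0:ℝ) 1, ∫ φ in Ioo (-π) π, max z 0 *
      u ((s * z) • (z • n + √(1 - z ^ 2) • (cos φ • Lambert.e₁ n + sin φ • Lambert.e₂ n))) =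
      ∫ z in Ioo (0:ℝ) 1, z * ∫ φ in Ioo (-π) π,
        u ((s * z) • (z • n + √(1 - z ^ 2) • (cos φ • Lambert.e₁ n + sin φ • Lambert.e₂ n))) := by
    refine setIntegral_congr_fun measurableSet_Ioo fun z hz => ?_
    rw [max_eq_left hz.1.le]
    exact integral_const_mul _ _
  have hJ : ∀ z : ℝ, (∫ φ in (-π)..π,
      u ((s * z) • (z • n + √(1 - z ^ 2) • (cos φ • Lambert.e₁ n + sin φ • Lambert.e₂ n)))) =
      ∫ φ in Ioo (-π) π, u ((s * z) • (z • n + √(1 - z ^ 2) • (cos φ • Lambert.e₁ n + sin φ • Lambert.e₂ n))) :=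
    fun z => by rw [intervalIntegral.integral_of_le (by linarith [pi_pos]), integral_Ioc_eq_integral_Ioo]
  have hR : (fun z : ℝ => 4 * z * ((2 * π)⁻¹ * ∫ φ in Ioo (-π) π,
      u ((s * z) • (z • n + √(1 - z ^ 2) • (cos φ • Lambert.e₁ n + sin φ • Lambert.e₂ n))))) =
      fun z : ℝ => (4 * (2 * π)⁻¹) * (z * ∫ φ in Ioo (-π) π,
        u ((s * z) • (z • n + √(1 - z ^ 2) • (cos φ • Lambert.e₁ n + sin φ • Lambert.e₂ n)))) := by
    funext z; ring
  simp_rw [hJ]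
  rw [hL, intervalIntegral.integral_of_le zero_le_one, integral_Ioc_eq_integral_Ioo, hR, integral_const_mul]
  field_simp
  ring

/-- **FACT F on separable functions** `u(r x) = a(r) Y(x)` (`r > 0`, `‖x‖ = 1`): for unit `n`, `0 ≤ s`, `u`
measurable and bounded on bounded sets,
`lorentzGain u (s n) = πs ∫₀¹ 4z a(sz) (A_z Y)(n) dz` — radius `s ↦ zs` with law `4z dz`, angle `n ↦` the circle
of height `z` (on the degree-`ℓ` harmonics `A_z` acts as `P_ℓ(z)`, whence the multipliers
`λ_ℓ(α) = 4∫₀¹ z^{α+1} P_ℓ(z) dz` of `…T12Indicial`). [folklore] -/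
theorem lorentzGain_smul_eq_circleAvg_of_separable {n : EuclideanSpace ℝ (Fin 3)} (hn : ‖n‖ = 1) {s : ℝ}
    (hs : 0 ≤ s) {u : EuclideanSpace ℝ (Fin 3) → ℝ} (hu : Measurable u)
    (hb : ∀ R : ℝ, ∃ C : ℝ, ∀ x, ‖x‖ ≤ R → |u x| ≤ C) {a : ℝ → ℝ} {Y : EuclideanSpace ℝ (Fin 3) → ℝ}
    (hsep : ∀ (r : ℝ) (x : EuclideanSpace ℝ (Fin 3)), 0 < r → ‖x‖ = 1 → u (r • x) = a r * Y x) :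
    lorentzGain u (s • n) = π * s * ∫ z in (0:ℝ)..1, 4 * z * a (s * z) * ((2 * π)⁻¹ * ∫ φ in (-π)..π,
      Y (z • n + √(1 - z ^ 2) • (cos φ • Lambert.e₁ n + sin φ • Lambert.e₂ n))) := by
  rcases hs.eq_or_lt with rfl | hs'
  · rw [zero_smul, lorentzGain_zero_right, mul_zero, zero_mul]
  rw [lorentzGain_smul_eq_circleAvg hn hs hu hb]
  congr 1
  refine intervalIntegral.integral_congr fun z hz => ?_
  rw [uIcc_of_le zero_le_one] at hz
  rcases hz.1.eq_or_lt with hz0 | hz0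
  · rw [← hz0]; ring
  have hsep' : ∀ φ : ℝ, u ((s * z) • (z • n + √(1 - z ^ 2) • (cos φ • Lambert.e₁ n + sin φ • Lambert.e₂ n))) =
      a (s * z) * Y (z • n + √(1 - z ^ 2) • (cos φ • Lambert.e₁ n + sin φ • Lambert.e₂ n)) := fun φ =>
    hsep _ _ (mul_pos hs' hz0) (norm_cylPoint hn (by nlinarith [hz.1, hz.2]) φ)
  simp_rw [hsep']
  rw [intervalIntegral.integral_const_mul]
  ring

/-! ### F3: two zonal steps as an iterated circle average -/

/-- A zonal operator applied to a bounded profile is measurable in the axis: `x ↦ ∫ k(⟪x, ω⟫) Y(ω) dσ(ω)`.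
[folklore] -/
theorem measurable_integral_sphere_zonal_mul {k : ℝ → ℝ} (hk : Measurable k)
    {Y : EuclideanSpace ℝ (Fin 3) → ℝ} (hY : Measurable Y) :
    Measurable fun x : EuclideanSpace ℝ (Fin 3) => ∫ ω : sphere (0 : EuclideanSpace ℝ (Fin 3)) 1,
      k ⟪x, (ω : EuclideanSpace ℝ (Fin 3))⟫_ℝ * Y ω ∂sphereMeasure := by
  have hf : Measurable fun p : EuclideanSpace ℝ (Fin 3) × sphere (0 : EuclideanSpace ℝ (Fin 3)) 1 =>
      k ⟪p.1, (p.2 : EuclideanSpace ℝ (Fin 3))⟫_ℝ * Y p.2 :=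
    (hk.comp (measurable_fst.inner (measurable_subtype_coe.comp measurable_snd))).mul
      (hY.comp (measurable_subtype_coe.comp measurable_snd))
  exact (hf.stronglyMeasurable.integral_prod_right'
    (ν := (sphereMeasure : Measure (sphere (0 : EuclideanSpace ℝ (Fin 3)) 1)))).measurable

/-- The zonal image of a bounded profile is bounded on the unit sphere:
`|∫ k(⟪x, ω⟫) Y(ω) dσ(ω)| ≤ 2π ∫_{-1}^{1} |k| · m` for `‖x‖ = 1`, `|Y| ≤ m`. [folklore] -/
theorem abs_integral_sphere_zonal_mul_le {x : EuclideanSpace ℝ (Fin 3)} (hx : ‖x‖ = 1) {k : ℝ → ℝ}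
    (hkI : IntervalIntegrable k volume (-1) 1) {Y : EuclideanSpace ℝ (Fin 3) → ℝ} {m : ℝ}
    (hm : ∀ y : EuclideanSpace ℝ (Fin 3), ‖y‖ = 1 → |Y y| ≤ m) :
    |∫ ω : sphere (0 : EuclideanSpace ℝ (Fin 3)) 1, k ⟪x, (ω : EuclideanSpace ℝ (Fin 3))⟫_ℝ * Y ω ∂sphereMeasure| ≤
      (2 * π * ∫ t in (-1:ℝ)..1, |k t|) * m := by
  have hkI' : IntervalIntegrable (fun t => |k t|) volume (-1) 1 := hkI.abs
  have h1 : ∫ ω : sphere (0 : EuclideanSpace ℝ (Fin 3)) 1, |k ⟪x, (ω : EuclideanSpace ℝ (Fin 3))⟫_ℝ| ∂sphereMeasure =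
      2 * π * ∫ t in (-1:ℝ)..1, |k t| :=
    integral_sphere_comp_inner_real hx (g := fun t => |k t|)
      ((intervalIntegrable_iff_integrableOn_Icc_of_le (by norm_num)).1 hkI').aestronglyMeasurable
  calc |∫ ω : sphere (0 : EuclideanSpace ℝ (Fin 3)) 1, k ⟪x, (ω : EuclideanSpace ℝ (Fin 3))⟫_ℝ * Y ω ∂sphereMeasure|
      ≤ ∫ ω : sphere (0 : EuclideanSpace ℝ (Fin 3)) 1, |k ⟪x, (ω : EuclideanSpace ℝ (Fin 3))⟫_ℝ * Y ω| ∂sphereMeasure :=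
        abs_integral_le_integral_abs
    _ ≤ ∫ ω : sphere (0 : EuclideanSpace ℝ (Fin 3)) 1, |k ⟪x, (ω : EuclideanSpace ℝ (Fin 3))⟫_ℝ| * m ∂sphereMeasure := by
        refine integral_mono_of_nonneg (Eventually.of_forall fun ω => abs_nonneg _)
          ((integrable_sphere_comp_inner_of_intervalIntegrable hx hkI').mul_const m)
          (Eventually.of_forall fun ω => ?_)
        dsimp only
        rw [abs_mul]
        exact mul_le_mul_of_nonneg_left (hm _ (by simp)) (abs_nonneg _)
    _ = (2 * π * ∫ t in (-1:ℝ)..1, |k t|) * m := by rw [integral_mul_const, h1]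

/-- **F3 — two zonal steps as an iterated circle average.** For unit `n`, a zonal weight `k` (measurable,
integrable on `[-1, 1]`) and a bounded measurable profile `Y`, the twice-applied zonal operator
`(K Y)(x) = ∫ k(⟪x, ω⟫) Y(ω) dσ(ω)` reads
`(K(K Y))(n) = ∫_{z₁} k(z₁) ∫_{φ₁} ∫_{z₂} k(z₂) ∫_{φ₂} Y(z₂ c₁ + √(1-z₂²)(cos φ₂ e₁ c₁ + sin φ₂ e₂ c₁)) dφ₂ dz₂ dφ₁ dz₁`,
`c₁ = z₁ n + √(1-z₁²)(cos φ₁ e₁ n + sin φ₁ e₂ n)` — `(2π)² ∫∫ k(z₁)k(z₂) (A_{z₁} A_{z₂} Y)(n) dz₁ dz₂`, the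
composition of circle averages of FF2 (the `k`-fold far-field iterate on separable functions). [folklore] -/
theorem integral_sphere_zonal_zonal_eq_cyl {n : EuclideanSpace ℝ (Fin 3)} (hn : ‖n‖ = 1) {k : ℝ → ℝ}
    (hk : Measurable k) (hkI : IntervalIntegrable k volume (-1) 1) {Y : EuclideanSpace ℝ (Fin 3) → ℝ}
    (hY : Measurable Y) {m : ℝ} (hm : ∀ x : EuclideanSpace ℝ (Fin 3), ‖x‖ = 1 → |Y x| ≤ m) :
    ∫ ω : sphere (0 : EuclideanSpace ℝ (Fin 3)) 1, k ⟪n, (ω : EuclideanSpace ℝ (Fin 3))⟫_ℝ *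
        (∫ ω' : sphere (0 : EuclideanSpace ℝ (Fin 3)) 1,
          k ⟪(ω : EuclideanSpace ℝ (Fin 3)), (ω' : EuclideanSpace ℝ (Fin 3))⟫_ℝ * Y ω' ∂sphereMeasure) ∂sphereMeasure =
      ∫ z₁ in Ioo (-1:ℝ) 1, k z₁ * ∫ φ₁ in Ioo (-π) π, ∫ z₂ in Ioo (-1:ℝ) 1, k z₂ * ∫ φ₂ in Ioo (-π) π,
        Y (z₂ • (z₁ • n + √(1 - z₁ ^ 2) • (cos φ₁ • Lambert.e₁ n + sin φ₁ • Lambert.e₂ n)) +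
          √(1 - z₂ ^ 2) • (cos φ₂ • Lambert.e₁ (z₁ • n + √(1 - z₁ ^ 2) • (cos φ₁ • Lambert.e₁ n + sin φ₁ • Lambert.e₂ n)) +
            sin φ₂ • Lambert.e₂ (z₁ • n + √(1 - z₁ ^ 2) • (cos φ₁ • Lambert.e₁ n + sin φ₁ • Lambert.e₂ n)))) := by
  have hY₁ := measurable_integral_sphere_zonal_mul hk hY
  have hb₁ : ∀ x : EuclideanSpace ℝ (Fin 3), ‖x‖ = 1 →
      |∫ ω' : sphere (0 : EuclideanSpace ℝ (Fin 3)) 1,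
        k ⟪x, (ω' : EuclideanSpace ℝ (Fin 3))⟫_ℝ * Y ω' ∂sphereMeasure| ≤ (2 * π * ∫ t in (-1:ℝ)..1, |k t|) * m :=
    fun x hx => abs_integral_sphere_zonal_mul_le hx hkI hm
  rw [integral_sphere_zonal_mul_eq_cyl hn hk hY₁ (integrable_sphere_zonal_mul hn hkI hY₁ hb₁)]
  refine setIntegral_congr_fun measurableSet_Ioo fun z₁ hz₁ => ?_
  congr 1
  refine setIntegral_congr_fun measurableSet_Ioo fun φ₁ _ => ?_
  have hc : ‖z₁ • n + √(1 - z₁ ^ 2) • (cos φ₁ • Lambert.e₁ n + sin φ₁ • Lambert.e₂ n)‖ = 1 :=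
    norm_cylPoint hn (by nlinarith [hz₁.1, hz₁.2]) φ₁
  exact integral_sphere_zonal_mul_eq_cyl hc hk hY (integrable_sphere_zonal_mul hc hkI hY hm)


/-! ### Registered helpers -/

/-- **Registered helper `t12_lorentzGain_circleAvg` — FACT F of the corrector-growth plan, the far-field
gain operator as an integral of circle averages.** For a unit vector `n`, `0 ≤ s` and `u : ℝ³ → ℝ` measurable
and bounded on bounded sets:
`lorentzGain u (s n) = πs ∫₀¹ 4z · (2π)⁻¹∫_{-π}^{π} u(sz (z n + √(1-z²)(cos φ e₁ n + sin φ e₂ n))) dφ dz = πs ∫₀¹ 4z (A_z u(sz ·))(n) dz`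
(frame `Lambert.e₁/e₂`): one far-field (partner at rest) collision step sends radius `s` to radius `zs` with the
law `4z dz` (own `2z` + partner `2z`, mass `2 = λ₀(0)`) and replaces the direction `n` by the normalised average
`A_z` over the circle of height `z` about `n`; dividing by `ν ≈ πs` gives the plan's
`(ν⁻¹K₂^∞u)(sn) = ∫₀¹ 4ρ (A_ρ u(ρs ·))(n) dρ`, whose separable case `u = r^α Y_ℓ` carries the multipliers
`λ_ℓ(α) = 4∫₀¹ρ^{α+1}P_ℓ(ρ)dρ` (`…T12Indicial`; `lorentzGain_smul_eq_circleAvg_of_separable`). Ingredients: the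
exchange symmetry / zonal form (`…T12LorentzAngular`) and cylindrical coordinates on `S²` (`…T12SphereCyl`).
[folklore] -/
theorem t12_lorentzGain_circleAvg : ∀ n : EuclideanSpace ℝ (Fin 3), ‖n‖ = 1 → ∀ s : ℝ, 0 ≤ s → ∀ u : EuclideanSpace ℝ (Fin 3) → ℝ, Measurable u → (∀ R : ℝ, ∃ C : ℝ, ∀ x : EuclideanSpace ℝ (Fin 3), ‖x‖ ≤ R → |u x| ≤ C) → Summit.AtomisticToContinuum.HydrodynamicLimit.Theorems.ClampedCorrectorBirth.lorentzGain u (s • n) = Real.pi * s * ∫ z in (0 : ℝ)..1, 4 * z * ((2 * Real.pi)⁻¹ * ∫ φ in (-Real.pi)..Real.pi, u ((s * z) • (z • n + Real.sqrt (1 - z ^ 2) • (Real.cos φ • Literature.Analysis.FluidPDE.Lambert.e₁ n + Real.sin φ • Literature.Analysis.FluidPDE.Lambert.e₂ n)))) :=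
  fun _ hn _ hs _ hu hb => lorentzGain_smul_eq_circleAvg hn hs hu hb

/-- **Registered helper `t12_funkHecke_circle` — Funk–Hecke for circles.** For a unit vector `n` of `ℝ³`,
a zonal weight `k : ℝ → ℝ` (measurable, integrable on `[-1, 1]`) and an angular profile `Y : ℝ³ → ℝ`
(measurable, `|Y| ≤ m` on the unit sphere):
`∫_{S²} k(⟪n, ν⟫) Y(ν) dσ(ν) = ∫_{-1}^{1} k(z) ∫_{-π}^{π} Y(z n + √(1-z²)(cos φ e₁ n + sin φ e₂ n)) dφ dz = 2π ∫_{-1}^{1} k(z) (A_z Y)(n) dz`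
— every zonal operator of the far-field calculus (one collision step `k = 2x₊ a(sx)`, its iterates, the zonal
and dipole projections `k = 1, x`: Z5 of the plan) is a one-dimensional integral of CIRCLE AVERAGES of the
profile; iterating gives the composition formula `integral_sphere_zonal_zonal_eq_cyl` (FF2, two steps).
[folklore] -/
theorem t12_funkHecke_circle : ∀ n : EuclideanSpace ℝ (Fin 3), ‖n‖ = 1 → ∀ (k : ℝ → ℝ) (Y : EuclideanSpace ℝ (Fin 3) → ℝ) (m : ℝ), Measurable k → IntervalIntegrable k MeasureTheory.volume (-1) 1 → Measurable Y → (∀ x : EuclideanSpace ℝ (Fin 3), ‖x‖ = 1 → |Y x| ≤ m) → ∫ ν : Metric.sphere (0 : EuclideanSpace ℝ (Fin 3)) 1, k (inner ℝ n (ν : EuclideanSpace ℝ (Fin 3))) * Y (ν : EuclideanSpace ℝ (Fin 3)) ∂Literature.MathematicalPhysics.KineticTheory.sphereMeasure = ∫ z in (-1 : ℝ)..1, k z * ∫ φ in (-Real.pi)..Real.pi, Y (z • n + Real.sqrt (1 - z ^ 2) • (Real.cos φ • Literature.Analysis.FluidPDE.Lambert.e₁ n + Real.sin φ • Literature.Analysis.FluidPDE.Lambert.e₂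 n)) :=
  fun _ hn _ _ _ hk hkI hY hm =>
    integral_sphere_zonal_mul_eq_intervalIntegral hn hk hY (integrable_sphere_zonal_mul hn hkI hY hm)

end Summit.AtomisticToContinuum.HydrodynamicLimit.Theorems.ClampedCorrectorBirth

end
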